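import Literature.AlgebraicGeometry.Motives.HodgeStructureHodgeVectorBlockHodgeNumbers
import Literature.AlgebraicGeometry.Motives.HodgeStructureHodgeVectorBlockCanonical
import HarnessLib

/-!
# THE HODGE-VECTOR BLOCK AND IRREDUCIBLE SUMMANDS: an irreducible Hodge structure has a Hodge vector only if it is the line `ℚ(−m)`;
# every irreducible sub-Hodge structure lies IN `V₀ = V ∩ V^{m,m}` (and is a line) or meets it trivially (polarized: lies in `V₀^⊥`);
# in ANY decomposition `V = ⊕ᵢ Sᵢ` into sub-Hodge structures `V₀ = ⊕ᵢ (Sᵢ ∩ V₀)`, and for irreducible `Sᵢ`: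
# `V₀ = ⊕_{Sᵢ ⊆ V₀} Sᵢ`, `dim V₀ = #{i : Sᵢ ⊆ V₀}` = the multiplicity of `ℚ(−m)` in `V`
# (Green–Griffiths–Kerr Ch. V Warning p. 154, §V.B «Basic facts» p. 159; Huybrechts §3.3.3, Cor. 3.3.6; Voisin I §7.3.1 Lemma 7.26; Moonen 2017 §2.1)

[topic AlgebraicGeometry/Motives]

Layer `Literature/AlgebraicGeometry/Motives`, lane `lit-hodgefound` (Track 2 foundations library; seat `lit-hodgefound-p02`, gen 41,
row g41-#8). THEOREMS ONLY: no definition, no named fact (D-0026 net debt `0`), no instance, no notation. Sequel BY NAME of g41-#6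
`Motives/HodgeStructureHodgeVectorBlockHodgeNumbers` (`exists_hom_toLinearMap_eq_of_hodgeClasses_eq_top`, `hodgeClasses_pure_eq_top`,
`exists_hom_bijective_of_hodgeClasses_eq_top`), g41-#4 `Motives/HodgeStructureHodgeVectorBlockCanonical`
(`Polarization.toSubmodule_le_orthogonal_hodgeClasses_of_hodgeClasses_eq_bot`), g41-#2 (`SubHodgeStructure.hodgeClasses_toHodgeStructure_eq_bot_iff`,
`…_eq_top_of_le`); from the tree: `HodgeStructure.IsIrreducible` (`Motives/HodgeStructureK3Type`), `Hom.exists_subHodgeStructure_range`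
(`Motives/HodgeStructureDirectSum`), the projections of an internal direct sum of sub-Hodge structures `SubHodgeStructure.internalProjHom`,
`isInternalProj`, `sum_isInternalProj_apply` (`Motives/HodgeStructureExteriorPowerLefschetzPolarization`), `Hom.map_hodgeClasses_le`. CITED BY
NAME, not imported (other cones): `exists_subHodgeStructure_of_le_hodgeClasses` (`Motives/KugaSatakeOfOrthogonalSummand`) and
`exists_subHodgeStructure_of_hodgeClasses_eq_top`, `IsIrreducible.finrank_eq_one_of_hodgeClasses_eq_top` (`Motives/HodgeGroupCommutativeStrongCM`,
through the Hodge group, under `[HodgeTensorFacts]`) — re-derived here Hodge-group-free from g41-#6 (§0–§1); the existence of a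
decomposition into irreducibles for polarizable `H` is the tree's `exists_isInternal_isIrreducible` (`Motives/HodgeStructureIrreducibleDecomposition`).

## The sources, verbatim

* M. Green, P. Griffiths, M. Kerr, *Mumford–Tate Groups and Domains* [GreenGriffithsKerr2012]: Ch. V p. 154, Warning preceding (V.4)
  (sub-Hodge structures of pure type `(n/2, n/2)` inside `V`); §V.B «Basic facts» p. 159 (third bullet: a semisimple object is the direct
  sum of its isotypic blocks, the multiplicity of a simple `S` counted in any decomposition).
* D. Huybrechts, *Lectures on K3 Surfaces* [Huybrechts2016K3], Ch. 3 §3.3.3 (irreducible Hodge structures), Cor. 3.3.6 (Schur).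
* C. Voisin, *Hodge Theory and Complex Algebraic Geometry I* [VoisinHodgeI2002], §7.3.1 Def. 7.24, Lemma 7.26 (sub-Hodge structures;
  projections of a direct sum are morphisms).
* B. Moonen, *Families of motives and the Mumford–Tate conjecture* [Moonen2017FamiliesMotives], §2.1 («`HS^{pol}_ℚ` is semisimple»).

## What is proved (`m + m = n`, `V₀ = H.hodgeClasses m`)

* §0 (plumbing, private) every subspace of `V₀` underlies a sub-Hodge structure (via the morphism `W_{(m,m)} → V` of g41-#6);
  `dim ⨆ᵢ Bᵢ = Σᵢ dim Bᵢ` for an independent family.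
* §1 **`IsIrreducible.hodgeClasses_eq_bot_or_eq_top`** (`V₀ = 0` or `V₀ = V`), **`IsIrreducible.finrank_eq_one_of_hodgeClasses_ne_bot`**
  (a Hodge vector forces `dim V = 1`), `IsIrreducible.hodgeClasses_eq_bot_of_finrank_ne_one` (irreducible of dimension `≠ 1` ⟹ no Hodge
  vectors), **`IsIrreducible.exists_hom_pure_bijective_of_hodgeClasses_ne_bot`** (`H ≅ ℚ(−m)`), `isIrreducible_of_finrank_eq_one`
  (a line is irreducible).
* §2 (irreducible SUB-Hodge structures) **`SubHodgeStructure.le_hodgeClasses_or_disjoint_of_isIrreducible`** (`S ⊆ V₀` or `S ∩ V₀ = 0`),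
  `SubHodgeStructure.finrank_eq_one_of_isIrreducible_of_le_hodgeClasses`, `SubHodgeStructure.le_hodgeClasses_iff_of_isIrreducible`
  (`S ⊆ V₀ ⟺ S ∩ V₀ ≠ 0`), **`Polarization.le_hodgeClasses_or_le_orthogonal_of_isIrreducible`** (`S ⊆ V₀` or `S ⊆ V₀^⊥`).
* §3 (internal direct sums `V = ⊕ᵢ Sᵢ` of sub-Hodge structures) **`mem_hodgeClasses_iff_forall_isInternalProj_mem`** (`v ∈ Hdgᵖ ⟺` all
  components `πᵢ v ∈ Hdgᵖ`), **`hodgeClasses_eq_iSup_inf_of_isInternal`** (`Hdgᵖ(V) = ⊕ᵢ (Sᵢ ∩ Hdgᵖ(V))`); for irreducible summands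
  **`hodgeClasses_eq_biSup_of_isInternal_of_isIrreducible`** (`V₀ = ⊕_{Sᵢ ⊆ V₀} Sᵢ`),
  **`finrank_hodgeClasses_eq_card_of_isInternal_of_isIrreducible`** (`dim V₀ = #{i : Sᵢ ⊆ V₀}`), `card_filter_le_finrank_hodgeClasses…`-free
  corollary `hodgeClasses_eq_bot_iff_forall_not_le_of_isInternal_of_isIrreducible` (`V₀ = 0 ⟺` no summand lies in `V₀`).

## References

* [GreenGriffithsKerr2012] M. Green, P. Griffiths, M. Kerr, *Mumford–Tate Groups and Domains*, Ann. of Math. Stud. 183 (2012): Ch. V p. 154, §V.B p. 159.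
* [Huybrechts2016K3] D. Huybrechts, *Lectures on K3 Surfaces*, CUP (2016): §3.3.3, Cor. 3.3.6.
* [VoisinHodgeI2002] C. Voisin, *Hodge Theory and Complex Algebraic Geometry I*, CUP (2002): §7.3.1 Def. 7.24, Lemma 7.26.
* [Moonen2017FamiliesMotives] B. Moonen, *Families of motives and the Mumford–Tate conjecture*, Milan J. Math. 85 (2017): §2.1.
-/

noncomputable section

open Module
open scoped TensorProduct

namespace Literature.AlgebraicGeometry.Motives

namespace HodgeStructure

universe u v

variable {V : Type u} [AddCommGroup V] [Module ℚ V] [Module.Finite ℚ V] {n : ℤ} {H : HodgeStructure V n}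

/-! ## §0 Plumbing -/

omit [Module.Finite ℚ V] in
/-- Every subspace `W ⊆ V₀` underlies a sub-Hodge structure: `W` is the image of the morphism `W_{(m,m)} → V` underlying the inclusion
(g41-#6 `exists_hom_toLinearMap_eq_of_hodgeClasses_eq_top`); the tree's `exists_subHodgeStructure_of_le_hodgeClasses`
(`Motives/KugaSatakeOfOrthogonalSummand`), re-derived in this cone. [cite: VoisinHodgeI2002, §7.3.1 Def. 7.24] [cite: GreenGriffithsKerr2012, Ch. V Warning p. 154] -/
private theorem exists_subHodgeStructure_eq_of_le_hodgeClasses₉ {m : ℤ} (hm : m + m = n) (W : Submodule ℚ V)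
    (hW : W ≤ H.hodgeClasses m) : ∃ S : SubHodgeStructure H, S.toSubmodule = W := by
  obtain ⟨φ, hφ⟩ := exists_hom_toLinearMap_eq_of_hodgeClasses_eq_top (H₂ := H) hm
    (hodgeClasses_pure_eq_top (↥W) m (show n = 2 * m by omega)) W.subtype (by rwa [Submodule.range_subtype])
  obtain ⟨S, hS⟩ := φ.exists_subHodgeStructure_range
  exact ⟨S, by rw [hS, hφ, Submodule.range_subtype]⟩

/-- `dim (⨆ᵢ Bᵢ) = Σᵢ dim Bᵢ` for an independent finite family of subspaces (through `⨁ᵢ Bᵢ ≃ ⨆ᵢ Bᵢ`). [folklore] -/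
private theorem finrank_iSup_eq_sum_of_iSupIndep₉ {K M : Type*} [Field K] [AddCommGroup M] [Module K M] {ι : Type*} [Fintype ι]
    (B : ι → Submodule K M) (hB : iSupIndep B) [∀ i, Module.Finite K (B i)] :
    finrank K ↥(⨆ i, B i) = ∑ i, finrank K (B i) := by
  classical
  have hinj := hB.dfinsupp_lsum_injective
  have hrange : LinearMap.range (DFinsupp.lsum ℕ (M := fun i => ↥(B i)) fun i => (B i).subtype) = ⨆ i, B i :=
    (Submodule.iSup_eq_range_dfinsupp_lsum B).symm
  rw [← hrange, LinearMap.finrank_range_of_inj hinj, ← Module.finrank_directSum]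
  rfl

/-! ## §1 Irreducible Hodge structures and Hodge vectors -/

omit [Module.Finite ℚ V] in
/-- **An irreducible Hodge structure has `V₀ = 0` or `V₀ = V`** (`V₀` underlies a sub-Hodge structure).
[cite: Huybrechts2016K3, §3.3.3] [cite: GreenGriffithsKerr2012, Ch. V Warning p. 154] -/
theorem IsIrreducible.hodgeClasses_eq_bot_or_eq_top (hirr : H.IsIrreducible) {m : ℤ} (hm : m + m = n) :
    H.hodgeClasses m = ⊥ ∨ H.hodgeClasses m = ⊤ := by
  obtain ⟨S, hS⟩ := exists_subHodgeStructure_eq_of_le_hodgeClasses₉ hm (H.hodgeClasses m) le_rfl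
  rw [← hS]
  exact hirr.eq_bot_or_eq_top S

omit [Module.Finite ℚ V] in
/-- **An irreducible Hodge structure with a non-zero Hodge vector is a line** (the line through a Hodge vector is a sub-Hodge
structure). The tree's `IsIrreducible.finrank_eq_one_of_hodgeClasses_eq_top` (`Motives/HodgeGroupCommutativeStrongCM`, via the Hodge
group) is the case `V₀ = V`; here Hodge-group-free. [cite: GreenGriffithsKerr2012, Ch. V Warning p. 154] [cite: Huybrechts2016K3, §3.3.3] -/
theorem IsIrreducible.finrank_eq_one_of_hodgeClasses_ne_bot (hirr : H.IsIrreducible) {m : ℤ} (hm : m + m = n)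
    (h : H.hodgeClasses m ≠ ⊥) : finrank ℚ V = 1 := by
  obtain ⟨v, hv, hv0⟩ := Submodule.exists_mem_ne_zero_of_ne_bot h
  obtain ⟨S, hS⟩ := exists_subHodgeStructure_eq_of_le_hodgeClasses₉ hm (ℚ ∙ v) ((Submodule.span_singleton_le_iff_mem v _).2 hv)
  rcases hirr.eq_bot_or_eq_top S with h0 | h1
  · exact absurd (Submodule.span_singleton_eq_bot.1 (hS ▸ h0)) hv0
  · rw [← finrank_top ℚ V, ← h1, hS, finrank_span_singleton hv0]

omit [Module.Finite ℚ V] in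
/-- **An irreducible Hodge structure of dimension `≠ 1` has no Hodge vectors.** [cite: GreenGriffithsKerr2012, Ch. V Warning p. 154]
[cite: Huybrechts2016K3, §3.3.3] -/
theorem IsIrreducible.hodgeClasses_eq_bot_of_finrank_ne_one (hirr : H.IsIrreducible) {m : ℤ} (hm : m + m = n)
    (hV : finrank ℚ V ≠ 1) : H.hodgeClasses m = ⊥ := by
  by_contra h
  exact hV (hirr.finrank_eq_one_of_hodgeClasses_ne_bot hm h)

/-- **An irreducible Hodge structure with a non-zero Hodge vector IS `ℚ(−m)`**: it is isomorphic to the structure purely of type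
`(m,m)` on `ℚ` (the tree's `pure ℚ m n`). [cite: GreenGriffithsKerr2012, §I.A p. 33 and Ch. V Warning p. 154] [cite: DeligneHodgeII1971, 2.1.13] -/
theorem IsIrreducible.exists_hom_pure_bijective_of_hodgeClasses_ne_bot (hirr : H.IsIrreducible) {m : ℤ} (hm : m + m = n)
    (hn : n = 2 * m) (h : H.hodgeClasses m ≠ ⊥) : ∃ φ : Hom (pure ℚ m n hn) H, Function.Bijective φ.toLinearMap := by
  have h1 := hirr.finrank_eq_one_of_hodgeClasses_ne_bot hm h
  have htop : H.hodgeClasses m = ⊤ := (hirr.hodgeClasses_eq_bot_or_eq_top hm).resolve_left h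
  exact exists_hom_bijective_of_hodgeClasses_eq_top hm (hodgeClasses_pure_eq_top ℚ m hn) htop
    (LinearEquiv.ofFinrankEq ℚ V (by rw [finrank_self, h1]))

/-- A Hodge structure on a line is irreducible. [cite: Huybrechts2016K3, §3.3.3] -/
theorem isIrreducible_of_finrank_eq_one (H : HodgeStructure V n) (h1 : finrank ℚ V = 1) : H.IsIrreducible := by
  haveI : Nontrivial V := Module.nontrivial_of_finrank_eq_succ h1
  refine ⟨inferInstance, fun S => ?_⟩
  rcases eq_or_ne S.toSubmodule ⊥ with h0 | h0
  · exact Or.inl h0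
  · right
    apply Submodule.eq_top_of_finrank_eq
    rw [h1]
    have hle : finrank ℚ S.toSubmodule ≤ 1 := h1 ▸ Submodule.finrank_le S.toSubmodule
    have hpos : 0 < finrank ℚ S.toSubmodule := finrank_pos_iff.2 (Submodule.nontrivial_iff_ne_bot.2 h0)
    omega

/-! ## §2 Irreducible sub-Hodge structures: inside `V₀` (a line) or disjoint from it (polarized: inside `V₀^⊥`) -/

omit [Module.Finite ℚ V] in
/-- **An irreducible sub-Hodge structure lies in `V₀` or meets it trivially** (`S ∩ V₀ = Hdgᵐ(S)` is `0` or `S`).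
[cite: GreenGriffithsKerr2012, Ch. V Warning p. 154] [cite: Huybrechts2016K3, §3.3.3] -/
theorem SubHodgeStructure.le_hodgeClasses_or_disjoint_of_isIrreducible (S : SubHodgeStructure H) (hirr : S.toHodgeStructure.IsIrreducible)
    {m : ℤ} (hm : m + m = n) : S.toSubmodule ≤ H.hodgeClasses m ∨ Disjoint S.toSubmodule (H.hodgeClasses m) := by
  rcases hirr.hodgeClasses_eq_bot_or_eq_top hm with h0 | h1
  · exact Or.inr ((S.hodgeClasses_toHodgeStructure_eq_bot_iff m).1 h0)
  · refine Or.inl fun v hv => ?_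
    exact (S.mem_hodgeClasses_iff m ⟨v, hv⟩).1 (h1 ▸ Submodule.mem_top)

omit [Module.Finite ℚ V] in
/-- **An irreducible sub-Hodge structure inside `V₀` is a line.** [cite: GreenGriffithsKerr2012, Ch. V Warning p. 154] -/
theorem SubHodgeStructure.finrank_eq_one_of_isIrreducible_of_le_hodgeClasses (S : SubHodgeStructure H)
    (hirr : S.toHodgeStructure.IsIrreducible) {m : ℤ} (hm : m + m = n) (hS : S.toSubmodule ≤ H.hodgeClasses m) :
    finrank ℚ S.toSubmodule = 1 := by
  refine hirr.finrank_eq_one_of_hodgeClasses_ne_bot hm ?_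
  rw [S.hodgeClasses_toHodgeStructure_eq_top_of_le hS]
  haveI := hirr.nontrivial
  exact top_ne_bot

omit [Module.Finite ℚ V] in
/-- For an irreducible sub-Hodge structure: `S ⊆ V₀ ⟺ S ∩ V₀ ≠ 0`. [cite: GreenGriffithsKerr2012, Ch. V Warning p. 154] -/
theorem SubHodgeStructure.le_hodgeClasses_iff_of_isIrreducible (S : SubHodgeStructure H) (hirr : S.toHodgeStructure.IsIrreducible)
    {m : ℤ} (hm : m + m = n) : S.toSubmodule ≤ H.hodgeClasses m ↔ ¬ Disjoint S.toSubmodule (H.hodgeClasses m) := by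
  refine ⟨fun h hd => ?_, fun h => (S.le_hodgeClasses_or_disjoint_of_isIrreducible hirr hm).resolve_right h⟩
  haveI := hirr.nontrivial
  exact (Submodule.nontrivial_iff_ne_bot.1 (inferInstance : Nontrivial S.toSubmodule)) (hd.eq_bot_of_le h)

/-- **In a polarized Hodge structure every irreducible sub-Hodge structure lies in `V₀` or in `V₀^⊥`** (disjoint from `V₀` means no
Hodge vectors, and Hodge-vector-free sub-Hodge structures lie in `V₀^⊥`, g41-#4). [cite: GreenGriffithsKerr2012, Ch. V Warning p. 154]
[cite: VoisinHodgeI2002, §7.3.1 Lemma 7.26] -/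
theorem Polarization.le_hodgeClasses_or_le_orthogonal_of_isIrreducible (ψ : Polarization H) {m : ℤ} (hm : m + m = n)
    (S : SubHodgeStructure H) (hirr : S.toHodgeStructure.IsIrreducible) :
    S.toSubmodule ≤ H.hodgeClasses m ∨ S.toSubmodule ≤ ψ.form.orthogonal (H.hodgeClasses m) := by
  rcases S.le_hodgeClasses_or_disjoint_of_isIrreducible hirr hm with h | h
  · exact Or.inl h
  · exact Or.inr (ψ.toSubmodule_le_orthogonal_hodgeClasses_of_hodgeClasses_eq_bot hm S ((S.hodgeClasses_toHodgeStructure_eq_bot_iff m).2 h))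

/-! ## §3 Decompositions `V = ⊕ᵢ Sᵢ` into sub-Hodge structures: `V₀ = ⊕ᵢ (Sᵢ ∩ V₀)`; irreducible summands -/

section Internal

variable {ι : Type v} [DecidableEq ι] [Fintype ι] (S : ι → SubHodgeStructure H) (hS : DirectSum.IsInternal fun i => (S i).toSubmodule)

omit [Module.Finite ℚ V] [Fintype ι] in
/-- The components `πᵢ v ∈ Sᵢ` of a Hodge class are Hodge classes (the projections are morphisms). [cite: VoisinHodgeI2002, §7.3.1 Lemma 7.26] -/
theorem isInternalProj_apply_mem_hodgeClasses {p : ℤ} {v : V} (hv : v ∈ H.hodgeClasses p) (i : ι) :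
    isInternalProj hS i v ∈ H.hodgeClasses p := by
  rw [← SubHodgeStructure.internalProjHom_toLinearMap S hS i]
  exact (SubHodgeStructure.internalProjHom S hS i).map_hodgeClasses_le p ⟨v, hv, rfl⟩

include hS in
omit [Module.Finite ℚ V] in
/-- **`v ∈ Hdgᵖ(V) ⟺ every component `πᵢ v ∈ Hdgᵖ(V)`** for `V = ⊕ᵢ Sᵢ`. [cite: VoisinHodgeI2002, §7.3.1 Lemma 7.26] -/
theorem mem_hodgeClasses_iff_forall_isInternalProj_mem (p : ℤ) (v : V) :
    v ∈ H.hodgeClasses p ↔ ∀ i, isInternalProj hS i v ∈ H.hodgeClasses p := by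
  refine ⟨fun hv i => isInternalProj_apply_mem_hodgeClasses S hS hv i, fun h => ?_⟩
  rw [← sum_isInternalProj_apply hS Finset.univ (fun j hj => absurd (Finset.mem_univ j) hj) v]
  exact Submodule.sum_mem _ fun i _ => h i

include hS in
omit [Module.Finite ℚ V] in
/-- **`Hdgᵖ(V) = ⊕ᵢ (Sᵢ ∩ Hdgᵖ(V))`** for a decomposition `V = ⊕ᵢ Sᵢ` into sub-Hodge structures. [cite: VoisinHodgeI2002, §7.3.1 Lemma 7.26]
[cite: GreenGriffithsKerr2012, §V.B p. 159] -/
theorem hodgeClasses_eq_iSup_inf_of_isInternal (p : ℤ) : H.hodgeClasses p = ⨆ i, (S i).toSubmodule ⊓ H.hodgeClasses p := by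
  refine le_antisymm (fun v hv => ?_) (iSup_le fun i => inf_le_right)
  rw [← sum_isInternalProj_apply hS Finset.univ (fun j hj => absurd (Finset.mem_univ j) hj) v]
  exact Submodule.sum_mem _ fun i _ =>
    Submodule.mem_iSup_of_mem i ⟨isInternalProj_apply_mem hS i v, isInternalProj_apply_mem_hodgeClasses S hS hv i⟩

include hS in
omit [Module.Finite ℚ V] in
/-- **`V₀ = ⊕_{Sᵢ ⊆ V₀} Sᵢ`** when the summands are irreducible (each `Sᵢ ∩ V₀` is `Sᵢ` or `0`). [cite: GreenGriffithsKerr2012, §V.B p. 159 and Ch. V Warning p. 154]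
[cite: Huybrechts2016K3, §3.3.3] -/
theorem hodgeClasses_eq_biSup_of_isInternal_of_isIrreducible (hirr : ∀ i, (S i).toHodgeStructure.IsIrreducible) {m : ℤ} (hm : m + m = n) :
    H.hodgeClasses m = ⨆ (i) (_ : (S i).toSubmodule ≤ H.hodgeClasses m), (S i).toSubmodule := by
  refine le_antisymm ((hodgeClasses_eq_iSup_inf_of_isInternal S hS m).le.trans (iSup_le fun i => ?_)) (iSup₂_le fun i hi => hi)
  rcases (S i).le_hodgeClasses_or_disjoint_of_isIrreducible (hirr i) hm with h | h
  · exact inf_le_left.trans (le_iSup₂_of_le i h le_rfl)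
  · rw [h.eq_bot]
    exact bot_le

include hS in
/-- **`dim V₀ = #{i : Sᵢ ⊆ V₀}`** — the multiplicity of `ℚ(−m)` in `V`, read off ANY decomposition into irreducible sub-Hodge
structures (each summand inside `V₀` is a line, and they are independent). [cite: GreenGriffithsKerr2012, §V.B p. 159 and Ch. V Warning p. 154]
[cite: Moonen2017FamiliesMotives, §2.1] -/
theorem finrank_hodgeClasses_eq_card_of_isInternal_of_isIrreducible (hirr : ∀ i, (S i).toHodgeStructure.IsIrreducible) {m : ℤ}
    (hm : m + m = n) : finrank ℚ (H.hodgeClasses m) = Nat.card {i // (S i).toSubmodule ≤ H.hodgeClasses m} := by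
  haveI : Fintype {i // (S i).toSubmodule ≤ H.hodgeClasses m} := Fintype.ofFinite _
  have hind : iSupIndep fun j : {i // (S i).toSubmodule ≤ H.hodgeClasses m} => (S j).toSubmodule :=
    hS.submodule_iSupIndep.comp Subtype.val_injective
  have heq : H.hodgeClasses m = ⨆ j : {i // (S i).toSubmodule ≤ H.hodgeClasses m}, (S j).toSubmodule :=
    (hodgeClasses_eq_biSup_of_isInternal_of_isIrreducible S hS hirr hm).trans
      (iSup_subtype' (p := fun i => (S i).toSubmodule ≤ H.hodgeClasses m) (f := fun i _ => (S i).toSubmodule))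
  rw [(LinearEquiv.ofEq _ _ heq).finrank_eq, finrank_iSup_eq_sum_of_iSupIndep₉ _ hind, Nat.card_eq_fintype_card, ← Finset.card_univ,
    Finset.card_eq_sum_ones]
  exact Finset.sum_congr rfl fun (j : {i // (S i).toSubmodule ≤ H.hodgeClasses m}) _ =>
    (S j.1).finrank_eq_one_of_isIrreducible_of_le_hodgeClasses (hirr j.1) hm j.2

include hS in
omit [Module.Finite ℚ V] in
/-- `V₀ = 0 ⟺` no irreducible summand lies in `V₀` (`⟺` no summand is the line `ℚ(−m)`). [cite: GreenGriffithsKerr2012, §V.B p. 159] -/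
theorem hodgeClasses_eq_bot_iff_forall_not_le_of_isInternal_of_isIrreducible (hirr : ∀ i, (S i).toHodgeStructure.IsIrreducible)
    {m : ℤ} (hm : m + m = n) : H.hodgeClasses m = ⊥ ↔ ∀ i, ¬ (S i).toSubmodule ≤ H.hodgeClasses m := by
  constructor
  · intro h i hi
    haveI := (hirr i).nontrivial
    exact (Submodule.nontrivial_iff_ne_bot.1 (inferInstance : Nontrivial (S i).toSubmodule)) (eq_bot_iff.2 (h ▸ hi))
  · intro h
    rw [hodgeClasses_eq_biSup_of_isInternal_of_isIrreducible S hS hirr hm]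
    exact eq_bot_iff.2 (iSup₂_le fun i hi => absurd hi (h i))

end Internal

end HodgeStructure

end Literature.AlgebraicGeometry.Motives

end
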